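import Mathlib
import HarnessLib

/-!
# Galerkin nonlinearities vanish on sign-type symmetry cells (Negative lane, supports `RungBlowupCofinal` / BC5 fallback)

Kernel form of the MECHANISM behind the census row «Z2-TET = DEAD ON ARRIVAL BY SYMMETRY» (case Z2-TET,
`HOME/profile/z2oct/OCT-REDUCED-SYSTEM.md` §1; profile-lead RULING (gx)(4), refuter5 K5-59): on the rung-3
tetrahedral cell `V₃` of the angular Galerkin ladder the projected nonlinearity `Π₃P((u·∇)u)` vanishes identically,
because the 90° rotation `g ∈ O ∖ T` acts on `V₃` as `−Id` while the Navier–Stokes nonlinearity is QUADRATIC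
(`N(−u) = N(u)`) and EQUIVARIANT (`N(ρ(g)u) = ρ(g)N(u)`), and the Galerkin–Leray projection onto `V₃` commutes with
`ρ(g)`.  The three-line argument is pure linear algebra; this file states and proves it ABSTRACTLY for a linear
operator `T` (the symmetry), a linear operator `P` (the projection onto the cell) and a map `N` (the nonlinearity)
on a module over a ring in which `2` is invertible — no fluid mechanics, no analysis:

* `proj_nonlinearity_eq_zero`: `T ∘ P = −P` (the cell is sign-type for `T`), `P ∘ T = T ∘ P`, `N` even and
  `T`-equivariant ⇒ `P (N u) = 0` for every `u` with `T u = −u`;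
* `proj_nonlinearity_eq_zero_of_mem_range`: the same for every `u` in the range of `P`.

Consequence (pen, not typed here: it needs the VSH decomposition of band-limited fields): the Galerkin dynamics
`NS₃|V₃` is the vector heat equation, so rung 3 has no tetrahedral-cell witness for `RungIsSingular 3`.
WHAT THIS IS NOT: not Navier–Stokes — an abstract parity lemma; nothing here asserts a Theses declaration.
-/

namespace Summit.NavierStokesRegularity.RungBlowupCofinalSignCell

variable {R E : Type*} [CommRing R] [AddCommGroup E] [Module R E]

/-- **Quadratic equivariant maps have no component along a sign-type cell.**  If a linear map `T` commutes with
the linear map `P`, acts as `−1` on the range of `P` (`T (P v) = −P v`), and `N : E → E` is even (`N (−u) = N u`)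
and `T`-equivariant (`N (T u) = T (N u)`), then `P (N u) = 0` whenever `T u = −u`, provided `2` is invertible
in the scalars. [folklore; OCT-REDUCED-SYSTEM.md §1] -/
theorem proj_nonlinearity_eq_zero [Invertible (2 : R)] (T P : E →ₗ[R] E) (N : E → E)
    (hPT : ∀ v, P (T v) = T (P v)) (hTP : ∀ v, T (P v) = -P v)
    (heven : ∀ u, N (-u) = N u) (hequiv : ∀ u, N (T u) = T (N u))
    {u : E} (hu : T u = -u) : P (N u) = 0 := by
  -- `T` fixes `N u`: `T (N u) = N (T u) = N (−u) = N u`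
  have hfix : T (N u) = N u := by rw [← hequiv, hu, heven]
  -- hence `P (N u) = P (T (N u)) = T (P (N u)) = −P (N u)`
  have hneg : P (N u) = -P (N u) := by
    calc P (N u) = P (T (N u)) := by rw [hfix]
      _ = T (P (N u)) := hPT _
      _ = -P (N u) := hTP _
  have h2 : (2 : R) • P (N u) = 0 := by
    rw [two_smul]
    nth_rewrite 2 [hneg]
    exact add_neg_cancel _
  have h3 : (⅟(2 : R) * 2) • P (N u) = 0 := by rw [mul_smul, h2, smul_zero]
  simpa using h3

/-- Range form: under the same hypotheses `P (N u) = 0` for every `u` in the range of `P` (every element of a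
sign-type cell is a `−1`-eigenvector of `T`). [folklore; OCT-REDUCED-SYSTEM.md §1] -/
theorem proj_nonlinearity_eq_zero_of_mem_range [Invertible (2 : R)] (T P : E →ₗ[R] E) (N : E → E)
    (hPT : ∀ v, P (T v) = T (P v)) (hTP : ∀ v, T (P v) = -P v)
    (heven : ∀ u, N (-u) = N u) (hequiv : ∀ u, N (T u) = T (N u))
    {u : E} (hu : u ∈ LinearMap.range P) : P (N u) = 0 := by
  obtain ⟨v, rfl⟩ := hu
  exact proj_nonlinearity_eq_zero T P N hPT hTP heven hequiv (hTP v)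

/-- **Idempotent form (the Galerkin reading).**  If moreover `P` is a projection (`P ∘ P = P`), the projected
vector field `u ↦ P (N u)` of the cell dynamics `uₜ = νΔu − P N u` VANISHES on the whole cell `range P`: the cell
dynamics is linear. [folklore; OCT-REDUCED-SYSTEM.md §1] -/
theorem proj_nonlinearity_comp_eq_zero [Invertible (2 : R)] (T P : E →ₗ[R] E) (N : E → E)
    (hPT : ∀ v, P (T v) = T (P v)) (hTP : ∀ v, T (P v) = -P v)
    (heven : ∀ u, N (-u) = N u) (hequiv : ∀ u, N (T u) = T (N u)) (v : E) :
    P (N (P v)) = 0 :=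
  proj_nonlinearity_eq_zero T P N hPT hTP heven hequiv (hTP v)

end Summit.NavierStokesRegularity.RungBlowupCofinalSignCell
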